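import Literature.NumberTheory.Automorphic.BookerStrongArtin
import Mathlib.Analysis.SpecialFunctions.Gamma.Basic
import HarnessLib

/-!
# Booker 2003 — proved pieces of the printed proof, I: the odd-case `Γ`-identity (23)

Sibling of `Automorphic/BookerStrongArtin.lean` (the named fact
`booker_strongArtin_of_artinConjecture`, Booker's Corollary, Ann. of Math. 158 (2003), p. 1090).
That Corollary is proved in print from (a) Booker's Theorem (a pole of some Dirichlet twist
`L(s, ρ ⊗ χ)` forces infinitely many poles of `L(s, ρ)`; Lemmas 1–4 and (17)–(23), pp. 1092–1097),
(b) Weil's converse theorem for `GL(2)` [20], (c) Brauer's meromorphy and functional equation of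
all twists, (d) Langlands–Tunnell for the solvable projective images (the tree's named fact
`strongArtin_of_isSolvable`). This file starts vendoring the analytic part (a) as THEOREMS, in the
order of the paper; the general Mellin-inversion `Ω`-lemma (Booker's Lemma 4) is proved in
`Literature/Analysis/Complex/MellinInvContinuation.lean`
(`Literature.Analysis.Complex.HalfPlaneDecay.not_isBigO_mellinInv`).

Here: **equation (23)** (p. 1097, "Modifications in the odd case"): "For odd representations, one
uses the `Γ`-factor `(2π)^{-s} Γ(s) (s - 1/2)^m` in (2). Lemma 3 then takes the form
`(2π)^{-s} Γ(s) (s - 1/2)^m = ∑_{k=0}^{m} b_k (2π)^{-s} Γ(s + k)`. This is an exact equation, and has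
a simpler proof not requiring Stirling's formula" — with, as in Lemma 3, `b_m > 0` (here
`b_m = 1`). Proof: induction on `m` with `Γ(s + k + 1) = (s + k) Γ(s + k)`, i.e.
`(s - 1/2) Γ(s + k) = Γ(s + k + 1) - (k + 1/2) Γ(s + k)`.

The identity is one of meromorphic functions; with Mathlib's values `Γ(-n) = 0` at the poles it is
stated for `s ∉ {0, -1, -2, …}` (at `s = 0`, `m = 1` it would read `0 = Γ(1) - Γ(0)/2 = 1`).

## References

* A. R. Booker, *Poles of Artin L-functions and the strong Artin conjecture*, Ann. of Math. (2)
  158 (2003), 1089–1098: (23), p. 1097; Lemma 3, p. 1094. [Booker2003]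
-/

noncomputable section

open Finset

namespace Literature.NumberTheory.Automorphic

namespace Booker2003

/-- The functional equation of `Γ` at the shifted points: for `s ∉ {0, -1, -2, …}` and `k ∈ ℕ`,
`Γ(s + k + 1) = (s + k) Γ(s + k)`. [folklore] -/
theorem Gamma_add_nat_add_one {s : ℂ} (hs : ∀ n : ℕ, s ≠ -n) (k : ℕ) :
    Complex.Gamma (s + k + 1) = (s + k) * Complex.Gamma (s + k) :=
  Complex.Gamma_add_one _ fun h0 ↦ hs k (by linear_combination h0)

/-- **Booker 2003, (23) (odd-case form of Lemma 3).** For every `m` there are real numbers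
`b_0, …, b_m` with `b_m = 1` (in particular `b_m > 0`, as Lemma 3 requires) such that
`Γ(s) (s - 1/2)^m = ∑_{k=0}^{m} b_k Γ(s + k)` for all `s ∉ {0, -1, -2, …}`; "an exact equation,
[with] a simpler proof not requiring Stirling's formula" — induction on `m` using
`(s - 1/2) Γ(s + k) = Γ(s + k + 1) - (k + 1/2) Γ(s + k)`. The coefficient sequence is extended
by `0` beyond `m`. [cite: Booker2003, (23) (p. 1097)] -/
theorem exists_Gamma_mul_sub_half_pow_eq_sum (m : ℕ) :
    ∃ b : ℕ → ℝ, b m = 1 ∧ (∀ k, m < k → b k = 0) ∧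
      ∀ s : ℂ, (∀ n : ℕ, s ≠ -n) →
        Complex.Gamma s * (s - 1 / 2) ^ m =
          ∑ k ∈ range (m + 1), (b k : ℂ) * Complex.Gamma (s + k) := by
  induction m with
  | zero =>
    refine ⟨fun k ↦ if k = 0 then 1 else 0, by simp, fun k hk ↦ ?_, fun s _ ↦ by simp⟩
    simp [Nat.pos_iff_ne_zero.mp hk]
  | succ m ih =>
    obtain ⟨b, hbm, hbz, hb⟩ := ih
    refine ⟨fun k ↦ (if k = 0 then 0 else b (k - 1)) - ((k : ℝ) + 1 / 2) * b k, ?_, ?_, ?_⟩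
    · simp [hbm, hbz (m + 1) (Nat.lt_succ_self m)]
    · intro k hk
      have hk0 : k ≠ 0 := by omega
      simp [hk0, hbz (k - 1) (by omega), hbz k (by omega)]
    · intro s hs
      have hΓ := Gamma_add_nat_add_one hs
      calc Complex.Gamma s * (s - 1 / 2) ^ (m + 1)
          = (Complex.Gamma s * (s - 1 / 2) ^ m) * (s - 1 / 2) := by ring
        _ = (∑ k ∈ range (m + 1), (b k : ℂ) * Complex.Gamma (s + k)) * (s - 1 / 2) := by
            rw [hb s hs]
        _ = ∑ k ∈ range (m + 1), ((b k : ℂ) * Complex.Gamma (s + k + 1)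
              - (b k : ℂ) * ((k : ℂ) + 1 / 2) * Complex.Gamma (s + k)) := by
            rw [Finset.sum_mul]
            refine Finset.sum_congr rfl fun k _ ↦ ?_
            rw [hΓ k]
            ring
        _ = (∑ k ∈ range (m + 1), (b k : ℂ) * Complex.Gamma (s + k + 1))
              - ∑ k ∈ range (m + 1), (b k : ℂ) * ((k : ℂ) + 1 / 2) * Complex.Gamma (s + k) := by
            rw [Finset.sum_sub_distrib]
        _ = (∑ k ∈ range (m + 2),
                ((if k = 0 then (0 : ℝ) else b (k - 1) : ℝ) : ℂ) * Complex.Gamma (s + k))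
              - ∑ k ∈ range (m + 2), (b k : ℂ) * ((k : ℂ) + 1 / 2) * Complex.Gamma (s + k) := by
            congr 1
            · rw [Finset.sum_range_succ' (fun k ↦
                ((if k = 0 then (0 : ℝ) else b (k - 1) : ℝ) : ℂ) * Complex.Gamma (s + k))]
              simp only [Nat.succ_ne_zero, if_false, Nat.add_sub_cancel, if_true,
                Complex.ofReal_zero, zero_mul, add_zero]
              refine Finset.sum_congr rfl fun k _ ↦ ?_
              push_cast
              ring_nf
            · rw [Finset.sum_range_succ _ (m + 1), hbz (m + 1) (Nat.lt_succ_self m)]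
              simp
        _ = ∑ k ∈ range (m + 1 + 1),
              (((if k = 0 then 0 else b (k - 1)) - ((k : ℝ) + 1 / 2) * b k : ℝ) : ℂ) *
                Complex.Gamma (s + k) := by
            rw [← Finset.sum_sub_distrib]
            refine Finset.sum_congr rfl fun k _ ↦ ?_
            push_cast
            ring

/-- **Booker 2003, (23) verbatim**, with the factor `(2π)^{-s}` of the odd `Γ`-factor:
`(2π)^{-s} Γ(s) (s - 1/2)^m = ∑_{k=0}^{m} b_k (2π)^{-s} Γ(s + k)` with `b_m = 1 > 0`, for
`s ∉ {0, -1, -2, …}`. [cite: Booker2003, (23) (p. 1097)] -/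
theorem exists_oddGammaFactor_mul_sub_half_pow_eq_sum (m : ℕ) :
    ∃ b : ℕ → ℝ, 0 < b m ∧ (∀ k, m < k → b k = 0) ∧
      ∀ s : ℂ, (∀ n : ℕ, s ≠ -n) →
        (2 * Real.pi : ℂ) ^ (-s) * Complex.Gamma s * (s - 1 / 2) ^ m =
          ∑ k ∈ range (m + 1), (b k : ℂ) * ((2 * Real.pi : ℂ) ^ (-s) * Complex.Gamma (s + k)) := by
  obtain ⟨b, hbm, hbz, hb⟩ := exists_Gamma_mul_sub_half_pow_eq_sum m
  refine ⟨b, by rw [hbm]; exact one_pos, hbz, fun s hs ↦ ?_⟩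
  rw [mul_assoc, hb s hs, Finset.mul_sum]
  refine Finset.sum_congr rfl fun k _ ↦ ?_
  ring

end Booker2003

end Literature.NumberTheory.Automorphic
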